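import Summits.Ventures.HodgeRepro2.T6N3Interface

/-!
# T6N3SideRich — STAGE 0 of the host `d3`: a RICH side with four interface Props discharged by construction

Cell pub-hodge-repro2, Tier 6 (README §10), seat t6-p3 (N3 owner). FILED in WAVE 1 (p437341, row 3d-1;
TARGET-T6.md v1.5 §11.0 decision (7); route/T6-N3-t6-p3.md v0.25 / v0.26 / v0.30 / v0.33); definition lane,
no display, no print input, no host object. v2 = a DOCSTRING-ONLY successor version (this header sentence
only; kernel content unchanged; count NONE).

THE SAME OBJECTS AS `N3Side` (T6N3Datum), presented the record's way so that four of the nineteen per-side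
interface Props of `T6N3Interface` are THEOREMS of the presentation instead of binders:
* the doubled Schwartz space is DEFINED as the tensor product `Sa ⊗[ℂ] Sb` (N3.2(c)) ⟹ `TensorsSpan`;
* the lift `K_ψ = ∫_{[G]} θ(φ)(g, h) \overline{ψ(h)} dh` is carried as a BOUNDED conjugate-linear map into the
  continuous functions `C([H])` (N3.L1; bounded in `ψ` by Cauchy–Schwarz on the compact quotient) ⟹
  `KliftCont`, and `Θ` is DEFINED from `K` by the Riesz representation (the record's common kernel:
  `⟨K_ψ, f⟩ = ⟨Θ(f, φ), ψ⟩` is Fubini) ⟹ `Adjoint`;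
* the isotypic component `Π(π₀) ≅ π₀ ⊗ M(π₀)` with `(m_j)` an orthonormal basis of `M(π₀)` (N3.2(e), N3.4) is
  carried as ONE isometric embedding of the orthogonal direct sum `⊕_{j < m₀} π₀` (the `ℓ²`-product
  `PiLp 2 (fun _ : Fin m₀ => π₀)`) into `L²([H])`, the copies being its restrictions to the summands ⟹
  `CopiesOrthogonal` (and each copy is a linear isometry by construction).

Everything else of `N3Side` is unchanged; `N3SideRich.toSide` is the forgetful bridge, and the four
theorems `toSide_tensorsSpan` / `toSide_kliftCont` / `toSide_adjoint` / `toSide_copiesOrthogonal` are the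
discharges. Per side 19 → 15 interface binders (v0.26 count), at equal DATA.

Conventions as in T6N3Datum: Mathlib's `⟪x, y⟫_ℂ` is conjugate-linear in `x`, linear in `y`.

§8(d): uses an L-value-free non-vanishing device: NO.
-/

namespace Summit.Ventures.HodgeRepro2.T6

open scoped InnerProductSpace TensorProduct

/-! ## 1. `Θ` from `K` by the Riesz representation -/

section Riesz

variable {LG LH : Type} [NormedAddCommGroup LG] [InnerProductSpace ℂ LG] [CompleteSpace LG]
  [NormedAddCommGroup LH] [InnerProductSpace ℂ LH]

/-- The bounded linear functional `ψ ↦ ⟪Kl ψ, f⟫` attached to a bounded conjugate-linear `Kl : LG → LH` and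
a vector `f ∈ LH` (linear in `ψ`: `Kl` is conjugate-linear and `⟪·, f⟫` is conjugate-linear). -/
noncomputable def rieszFunctional (Kl : LG →L⋆[ℂ] LH) (f : LH) : StrongDual ℂ LG :=
  LinearMap.mkContinuous
    { toFun := fun ψ => ⟪Kl ψ, f⟫_ℂ
      map_add' := fun ψ₁ ψ₂ => by simp
      map_smul' := fun c ψ => by simp [mul_comm] }
    (‖Kl‖ * ‖f‖) (fun ψ => by
      calc ‖⟪Kl ψ, f⟫_ℂ‖ ≤ ‖Kl ψ‖ * ‖f‖ := norm_inner_le_norm _ _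
        _ ≤ ‖Kl‖ * ‖ψ‖ * ‖f‖ := by gcongr; exact Kl.le_opNorm ψ
        _ = ‖Kl‖ * ‖f‖ * ‖ψ‖ := by ring)

omit [CompleteSpace LG] in
/-- `rieszFunctional Kl f ψ = ⟪Kl ψ, f⟫`. -/
@[simp] theorem rieszFunctional_apply (Kl : LG →L⋆[ℂ] LH) (f : LH) (ψ : LG) :
    rieszFunctional Kl f ψ = ⟪Kl ψ, f⟫_ℂ := rfl

/-- THE THETA VECTOR: `Θ f := (toDual ℂ LG).symm (ψ ↦ ⟪Kl ψ, f⟫)`, the vector of `LG` with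
`⟪Θ f, ψ⟫ = ⟪Kl ψ, f⟫` for all `ψ` (the record's `Θ(f, φ)`, defined from `K` by the common kernel). -/
noncomputable def thetaVec (Kl : LG →L⋆[ℂ] LH) (f : LH) : LG :=
  (InnerProductSpace.toDual ℂ LG).symm (rieszFunctional Kl f)

/-- `⟪Θ f, ψ⟫ = ⟪Kl ψ, f⟫`. -/
theorem inner_thetaVec_left (Kl : LG →L⋆[ℂ] LH) (f : LH) (ψ : LG) :
    ⟪thetaVec Kl f, ψ⟫_ℂ = ⟪Kl ψ, f⟫_ℂ := by
  unfold thetaVec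
  rw [InnerProductSpace.toDual_symm_apply, rieszFunctional_apply]

/-- THE ADJOINT IDENTITY `⟪f, Kl ψ⟫ = ⟪ψ, Θ f⟫` (N3.L2, in Mathlib's convention). -/
theorem inner_thetaVec_right (Kl : LG →L⋆[ℂ] LH) (f : LH) (ψ : LG) :
    ⟪ψ, thetaVec Kl f⟫_ℂ = ⟪f, Kl ψ⟫_ℂ := by
  rw [← inner_conj_symm, inner_thetaVec_left, inner_conj_symm]

/-- `f ↦ Θ f` is conjugate-linear. -/
noncomputable def thetaMap (Kl : LG →L⋆[ℂ] LH) : LH →ₗ⋆[ℂ] LG where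
  toFun := thetaVec Kl
  map_add' f g := ext_inner_right ℂ fun ψ => by
    simp only [inner_thetaVec_left, inner_add_left, inner_add_right]
  map_smul' c f := ext_inner_right ℂ fun ψ => by
    simp only [inner_thetaVec_left, inner_smul_left, inner_smul_right, starRingEnd_self_apply]

/-- `thetaMap Kl f = thetaVec Kl f`. -/
@[simp] theorem thetaMap_apply (Kl : LG →L⋆[ℂ] LH) (f : LH) : thetaMap Kl f = thetaVec Kl f := rfl

variable {S : Type} [AddCommGroup S] [Module ℂ S]

/-- `Θ : S →ₗ[ℂ] (LH →ₗ⋆[ℂ] LG)` from a Schwartz-linear family of bounded lifts `Klift : S →ₗ[ℂ] (LG →L⋆[ℂ] LH)`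
(linear in the datum `φ`, conjugate-linear in `f`). -/
noncomputable def theta (Klift : S →ₗ[ℂ] (LG →L⋆[ℂ] LH)) : S →ₗ[ℂ] (LH →ₗ⋆[ℂ] LG) where
  toFun φ := thetaMap (Klift φ)
  map_add' φ₁ φ₂ := LinearMap.ext fun f => ext_inner_right ℂ fun ψ => by
    simp only [thetaMap_apply, LinearMap.add_apply, inner_thetaVec_left, map_add, add_apply,
      inner_add_left]
  map_smul' c φ := LinearMap.ext fun f => ext_inner_right ℂ fun ψ => by
    simp only [thetaMap_apply, LinearMap.smul_apply, inner_thetaVec_left, map_smul, smul_apply,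
      inner_smul_left, RingHom.id_apply]

/-- `theta Klift φ f = thetaVec (Klift φ) f`. -/
@[simp] theorem theta_apply (Klift : S →ₗ[ℂ] (LG →L⋆[ℂ] LH)) (φ : S) (f : LH) :
    theta Klift φ f = thetaVec (Klift φ) f := rfl

end Riesz

/-! ## 2. The summand embeddings of the `ℓ²`-product `⊕_{j < m₀} π₀` -/

section Single

variable {E : Type} [NormedAddCommGroup E] [InnerProductSpace ℂ E] {n : ℕ}

/-- The `j`-th summand `v ↦ (0, …, v, …, 0)` of the `ℓ²`-product of `n` copies of `E`, a linear isometry. -/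
noncomputable def singleLI (j : Fin n) : E →ₗᵢ[ℂ] PiLp 2 (fun _ : Fin n => E) where
  toFun v := PiLp.single 2 j v
  map_add' v w := PiLp.single_add 2 j
  map_smul' c v := by
    ext k
    by_cases hk : k = j
    · subst hk; simp
    · simp [hk]
  norm_map' v := PiLp.norm_single 2 (fun _ : Fin n => E) j v

/-- `singleLI j v = PiLp.single 2 j v`. -/
@[simp] theorem singleLI_apply (j : Fin n) (v : E) : singleLI j v = PiLp.single 2 j v := rfl

/-- Distinct summands are orthogonal. -/
theorem inner_singleLI_of_ne {i j : Fin n} (hij : i ≠ j) (v w : E) :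
    ⟪singleLI i v, singleLI j w⟫_ℂ = 0 := by
  simp only [singleLI_apply, PiLp.inner_apply]
  refine Finset.sum_eq_zero fun k _ => ?_
  by_cases hk : k = i
  · subst hk
    rw [PiLp.single_eq_of_ne (β := fun _ : Fin n => E) 2 hij w, inner_zero_right]
  · rw [PiLp.single_eq_of_ne (β := fun _ : Fin n => E) 2 hk v, inner_zero_left]

end Single

/-! ## 3. The rich side -/

/-- A RICH SIDE of Proposition N*: the objects of `N3Side` (T6N3Datum) with the doubled Schwartz space
`S = Sa ⊗[ℂ] Sb` (N3.2(c)), the lift `K` bounded and continuous-valued (N3.L1), `Θ` derived from `K`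
(N3.L2), and the isotypic component `Π(π₀) ≅ ⊕_{j < m₀} π₀ ⊗ m_j` carried as one isometric embedding of the
`ℓ²`-product of `m₀` copies of `π₀` (N3.2(e), N3.4). Every field is an OBJECT of the record; no field is a
theorem. -/
structure N3SideRich (LG : Type) [NormedAddCommGroup LG] [InnerProductSpace ℂ LG] [CompleteSpace LG]
    (Gf : Type) [Group Gf] where
  /-- `L²([H])` -/
  LH : Type
  [instNormedAddCommGroupLH : NormedAddCommGroup LH]
  [instInnerProductSpaceLH : InnerProductSpace ℂ LH]
  [instCompleteSpaceLH : CompleteSpace LH]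
  /-- `H(𝔸_f)` -/
  Hf : Type
  [instGroupHf : Group Hf]
  /-- right translation on `L²([H])` -/
  R : Hf → LH →ₗᵢ[ℂ] LH
  /-- the level `K ⊂ H(𝔸_f)` -/
  K : Subgroup Hf
  /-- the finite Schwartz data of the first line -/
  Sa : Type
  [instAddCommGroupSa : AddCommGroup Sa]
  [instModuleSa : Module ℂ Sa]
  /-- the finite Schwartz data of the second line -/
  Sb : Type
  [instAddCommGroupSb : AddCommGroup Sb]
  [instModuleSb : Module ℂ Sb]
  /-- the Weil representation of `H(𝔸_f)` on the doubled data `𝒮(𝕏(𝔸_f)) = Sa ⊗ Sb` -/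
  ωH : Hf → (Sa ⊗[ℂ] Sb) →ₗ[ℂ] (Sa ⊗[ℂ] Sb)
  /-- the Weil representation of `G(𝔸_f)` on the first line's data -/
  ωGa : Gf → Sa →ₗ[ℂ] Sa
  /-- the Weil representation of `G(𝔸_f)` on the second line's data -/
  ωGb : Gf → Sb →ₗ[ℂ] Sb
  /-- `C([H]) ⊂ L²([H])` -/
  Cont : Submodule ℂ LH
  /-- THE LIFT `K_ψ(g) = ∫_{[G]} θ(φ)(g, h) \overline{ψ(h)} dh`, a continuous function of `g` (N3.L1), bounded
  conjugate-linear in `ψ` (Cauchy–Schwarz on the compact `[G]`), linear in the datum `φ` -/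
  Klift : (Sa ⊗[ℂ] Sb) →ₗ[ℂ] (LG →L⋆[ℂ] Cont)
  /-- `σ = Θ_V(π₀) ⊂ L²([G])` -/
  σ : Submodule ℂ LG
  /-- `π₀ ⊂ L²([H])` -/
  π₀ : Submodule ℂ LH
  /-- `m₀ = m(π₀) = dim M(π₀)` -/
  m₀ : ℕ
  /-- THE ISOTYPIC EMBEDDING `⊕_{j < m₀} π₀ → L²([H])`, `(v_j)_j ↦ Σ_j v_j ⊗ m_j`, an isometry (`(m_j)`
  orthonormal), whose restriction to the `j`-th summand is the copy `π₀ ⊗ m_j` -/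
  ι : PiLp 2 (fun _ : Fin m₀ => π₀) →ₗᵢ[ℂ] LH
  /-- the `τ′`-isotypic vectors of `L²([H])` -/
  τ'iso : Submodule ℂ LH
  /-- the toric period on `C([H])` -/
  Ptor : Cont →ₗ[ℂ] ℂ
  /-- the product of the two vertex forms -/
  F : Sa →ₗ[ℂ] Sb →ₗ[ℂ] LG

namespace N3SideRich

variable {LG : Type} [NormedAddCommGroup LG] [InnerProductSpace ℂ LG] [CompleteSpace LG]
  {Gf : Type} [Group Gf] (X : N3SideRich LG Gf)

/-- the normed group structure of `L²([H])` (field) -/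
instance : NormedAddCommGroup X.LH := X.instNormedAddCommGroupLH
/-- the inner product of `L²([H])` (field) -/
instance : InnerProductSpace ℂ X.LH := X.instInnerProductSpaceLH
/-- `L²([H])` is complete (field) -/
instance : CompleteSpace X.LH := X.instCompleteSpaceLH
/-- the group structure of `H(𝔸_f)` (field) -/
instance : Group X.Hf := X.instGroupHf
/-- the additive structure of the first line's data (field) -/
instance : AddCommGroup X.Sa := X.instAddCommGroupSa
/-- the ℂ-structure of the first line's data (field) -/
instance : Module ℂ X.Sa := X.instModuleSa
/-- the additive structure of the second line's data (field) -/
instance : AddCommGroup X.Sb := X.instAddCommGroupSb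
/-- the ℂ-structure of the second line's data (field) -/
instance : Module ℂ X.Sb := X.instModuleSb

/-- The lift read in `L²([H])` (the continuous function as a square-integrable one). -/
noncomputable def kliftL (φ : X.Sa ⊗[ℂ] X.Sb) : LG →L⋆[ℂ] X.LH :=
  X.Cont.subtypeL.comp (X.Klift φ)

/-- `kliftL φ ψ = ↑(Klift φ ψ)`. -/
@[simp] theorem kliftL_apply (φ : X.Sa ⊗[ℂ] X.Sb) (ψ : LG) : X.kliftL φ ψ = (X.Klift φ ψ : X.LH) := rfl

/-- `φ ↦ kliftL φ`, linear in the datum. -/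
noncomputable def kliftLin : (X.Sa ⊗[ℂ] X.Sb) →ₗ[ℂ] (LG →L⋆[ℂ] X.LH) where
  toFun := X.kliftL
  map_add' φ₁ φ₂ := ContinuousLinearMap.ext fun ψ => by simp
  map_smul' c φ := ContinuousLinearMap.ext fun ψ => by simp

/-- `kliftLin φ = kliftL φ`. -/
@[simp] theorem kliftLin_apply (φ : X.Sa ⊗[ℂ] X.Sb) : X.kliftLin φ = X.kliftL φ := rfl

/-- The lift as a plain conjugate-linear map into `L²([H])` (the shape of the field `N3Side.Klift`). -/
noncomputable def kliftSide : (X.Sa ⊗[ℂ] X.Sb) →ₗ[ℂ] (LG →ₗ⋆[ℂ] X.LH) where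
  toFun φ := (X.kliftL φ).toLinearMap
  map_add' φ₁ φ₂ := LinearMap.ext fun ψ => by simp
  map_smul' c φ := LinearMap.ext fun ψ => by simp

/-- `kliftSide φ ψ = ↑(Klift φ ψ)`. -/
@[simp] theorem kliftSide_apply (φ : X.Sa ⊗[ℂ] X.Sb) (ψ : LG) :
    X.kliftSide φ ψ = (X.Klift φ ψ : X.LH) := rfl

/-- The copies `π₀ ⊗ m_j ⊂ L²([H])`: the restriction of the isotypic embedding to the `j`-th summand. -/
noncomputable def copy (j : Fin X.m₀) : X.π₀ →ₗᵢ[ℂ] X.LH :=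
  X.ι.comp (singleLI j)

/-- `copy j v = ι (single j v)`. -/
@[simp] theorem copy_apply (j : Fin X.m₀) (v : X.π₀) : X.copy j v = X.ι (singleLI j v) := rfl

/-- THE FORGETFUL BRIDGE to the datum of record: `S := Sa ⊗ Sb`, `tensor := ⊗ₜ`, `ωG := ωGa ⊗ ωGb`,
`Θ := theta Klift`, `Klift` read in `L²([H])`, `copy j := ι ∘ single j` (an `abbrev`, so that the fields of
`X.toSide` reduce to those of `X` — the toy instances need this). -/
noncomputable abbrev toSide : N3Side LG Gf where
  LH := X.LH
  Hf := X.Hf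
  R := X.R
  K := X.K
  Sa := X.Sa
  Sb := X.Sb
  S := X.Sa ⊗[ℂ] X.Sb
  tensor := TensorProduct.mk ℂ X.Sa X.Sb
  ωH := X.ωH
  ωG g := TensorProduct.map (X.ωGa g) (X.ωGb g)
  ωGa := X.ωGa
  ωGb := X.ωGb
  Θ := theta X.kliftLin
  Klift := X.kliftSide
  σ := X.σ
  π₀ := X.π₀
  m₀ := X.m₀
  copy := X.copy
  τ'iso := X.τ'iso
  Cont := X.Cont
  Ptor := X.Ptor
  F := X.F

/-! ## 4. The four discharges -/

/-- `TensorsSpan` on the rich side: the pure tensors span `Sa ⊗ Sb` (N3.2(c), by construction). -/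
theorem toSide_tensorsSpan : X.toSide.TensorsSpan := by
  unfold N3Side.TensorsSpan
  have h := TensorProduct.span_tmul_eq_top ℂ X.Sa X.Sb
  have hset : (Set.range fun p : X.Sa × X.Sb => X.toSide.tensor p.1 p.2) =
      {t : X.Sa ⊗[ℂ] X.Sb | ∃ m n, m ⊗ₜ n = t} := by
    ext t
    constructor
    · rintro ⟨⟨a, b⟩, rfl⟩
      exact ⟨a, b, rfl⟩
    · rintro ⟨a, b, rfl⟩
      exact ⟨(a, b), rfl⟩
  rw [show (⊤ : Submodule ℂ X.toSide.S) = Submodule.span ℂ {t : X.Sa ⊗[ℂ] X.Sb | ∃ m n, m ⊗ₜ n = t}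
    from h.symm]
  exact le_of_eq (congrArg (Submodule.span ℂ) hset.symm)

/-- `KliftCont` on the rich side: the lift lands in `C([H])` (N3.L1, by construction). -/
theorem toSide_kliftCont : X.toSide.KliftCont := fun φ ψ => (X.Klift φ ψ).2

/-- `Adjoint` on the rich side: `⟪f, K_ψ⟫ = ⟪ψ, Θ f⟫` (N3.L2, by the Riesz construction of `Θ`). -/
theorem toSide_adjoint : X.toSide.Adjoint := fun φ f ψ => by
  show ⟪f, X.kliftSide φ ψ⟫_ℂ = ⟪ψ, theta X.kliftLin φ f⟫_ℂ
  rw [theta_apply, inner_thetaVec_right]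
  rfl

/-- `CopiesOrthogonal` on the rich side: distinct copies are orthogonal (`(m_j)` orthonormal, by construction). -/
theorem toSide_copiesOrthogonal : X.toSide.CopiesOrthogonal := fun _ _ hij v w =>
  (X.ι.inner_map_map _ _).trans (inner_singleLI_of_ne hij v w)

end N3SideRich

end Summit.Ventures.HodgeRepro2.T6
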